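import Summits.Ventures.LatticeQCDFlow.Scoring.MadrasSokalWindow

/-!
# The Madras–Sokal window on a TWO-scale autocorrelation function: the windowing trap, typed

HONEST FRAMING: exact (Metropolis-corrected) sampling algorithms for lattice gauge theory;
figures of merit are autocorrelation/cost numbers at stated couplings and volumes; no
continuum-physics claim.

Venture `LatticeQCDFlow` (cell pub-lqcd), sub-topic `Scoring`; FANOUT row 2 (`s0-phi4`, the
STEP-0 2D φ⁴ calibration rung S0-A and the exactness battery).  NEW WORK of the cell (elementary
series arithmetic), companion of row 11's `Scoring/MadrasSokalWindow.lean`; nothing here is cited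
as a fact and nothing frozen (FITNESS.md, scorers A 0.1.2 / B 0.1.8) is touched or questioned.

## Why this file exists

`MadrasSokalWindow.relBias_lt_of_isMSWindow` says that on a ONE-scale curve `ρ t = r^t` the
self-consistent window `W* = min {W ≥ 1 : c·τ̂_W ≤ W}` leaves a relative truncation bias
`< exp(−c τ̂_W/τ_exp)` — small.  Two places in the cell met the converse phenomenon on TWO-scale
curves `ρ t = a r^t + b s^t` (fast `r`, slow `s`, small slow amplitude `b`):

* calibration set **C-1b** of both scorers ("two-scale windowing trap", `CalibrationTruths.tauInt_C1b`:
  `a = 10/11, r = 1/2, b = 1/11, s = 999/1000`, `τ_int = 2029/22 = 92.23`), on which scorer A's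
  Madras–Sokal cross-check scan of record reads (CALIBRATION-A-j121257-0.1.2-of-record.md l.14,
  one sample series): `c = 4: W 9, τ̂ 2.2147 · c = 6: W 19, τ̂ 3.0986 · c = 8: W 39, τ̂ 4.850 ·
  c = 10: W 99, τ̂ 9.886` (its automatic window reads 16.81 and the `window-underestimate` flag fires;
  the long-lag estimate 97.3 ± 6.1 is the value used);
* row 2's adjudication of the one FAIL of rung S0-A (HOME/s0-phi4/RESULTS-S0-A.md §3, sealed item
  adj-06, local-Metropolis `G(0,0)`): an observable whose ACF drops to `0.31–0.38` after one stored
  step and then carries a slow tail of amplitude `0.02–0.07` on the `χ₂` time-scale; its fitted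
  dynamical exponent moved with the window constant, `0.99 (c = 4) → 1.21 (c = 6, primary) → 1.26 (8)
  → 1.30 (10) → 1.33–1.41` (converged windows), against a printed `1.49(8)` — the lead's ruling RA-37
  commended that lesson to rows 3/4/5 and the LEADERBOARD-2 docket.

What is proved is the population mechanism behind both, exactly:

## Content (`tauInt`, `tauIntWindow`, `relBias`, `IsMSWindow` as in the companion files)

* `isMSWindow_le_of_crossing`, `exists_isMSWindow_of_crossing` — for ANY windowed curve: a crossing
  `c·τ̂_{W₀} ≤ W₀` at some `W₀ ≥ 1` forces the MS window to exist and to satisfy `W* ≤ W₀` (first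
  crossing); `tauIntWindow_mono` — for a non-negative ACF the windowed sum is monotone in `W`.
* `tauIntWindow_mixture`, `tauInt_sub_tauIntWindow_mixture` — closed forms on the two-scale curve:
  the window `W` misses exactly `a r^(W+1)/(1−r) + b s^(W+1)/(1−s)`.
* **`ms_crossing_of_small_amplitude`** — the trap: if `c·b < 1` then EVERY `W₀ ≥ c(½ + a r/(1−r))/(1 − c b)`
  is a crossing, WHATEVER the slow scale `s ∈ [0, 1]` is (the slow component contributes at most `b·W₀`
  to `τ̂_{W₀}`).  Hence (`tauIntWindow_le_of_isMSWindow_le`, `bias_ge_of_isMSWindow_mixture`,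
  `relBias_ge_of_isMSWindow_mixture`) the MS reading is `≤ W₀/c` independently of `s`, the absolute
  bias is `≥ b s^(W₀+1)/(1−s)` — unbounded as `s → 1` — and the relative bias is `≥ 1 − (W₀/c)/τ_int`.
* **C-1b at the scorers' constants** (`c = 6` is scorer B's window of record and a member of scorer A's
  scan; `c = 4` is the thesis rule row 2 compared against): on the POPULATION curve the MS windows are
  exactly `W* = 9` at `c = 4` and `W* = 19` at `c = 6` (`isMSWindow_C1b_c4`, `isMSWindow_C1b_c6`) — the
  `W` columns of the calibration of record above, digit for digit — with readings
  `2.221 < τ̂_9 < 2.222` and `3.119 < τ̂_19 < 3.120` (sample: 2.2147 / 3.0986) against `τ_int = 92.23`,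
  i.e. relative truncation bias `> 0.975` and `> 0.966` (`relBias_C1b_c4_gt`, `relBias_C1b_c6_gt`).

NOT claimed: anything about sample fluctuations of `ρ̂` (population curve only); the exponent
arithmetic of RESULTS-S0-A §3 (three volumes, fits) — only its single-volume mechanism; which window
is "right" — the frozen conventions of FITNESS.md stand, and scorer A's own guard (`window-underestimate`
+ long-lag estimator) is exactly what catches C-1b in the calibration of record.
-/

namespace Summit.Ventures.LatticeQCDFlow.Scoring

open scoped BigOperators

/-! ## General facts about the self-consistent window (any curve) -/

/-- **First crossing**: if `W₀ ≥ 1` already satisfies the Madras–Sokal inequality `c·τ̂_{W₀} ≤ W₀`,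
then THE MS window is at most `W₀`. [ours] -/
theorem isMSWindow_le_of_crossing {c : ℝ} {τW : ℕ → ℝ} {W W₀ : ℕ}
    (hW : IsMSWindow c τW W) (h₀ : 1 ≤ W₀) (hcross : c * τW W₀ ≤ W₀) : W ≤ W₀ := by
  by_contra hlt
  exact absurd hcross (not_le.mpr (hW.2.2 W₀ h₀ (not_le.mp hlt)))

/-- A crossing at some `W₀ ≥ 1` makes the MS window exist (and lie at or below `W₀`). [ours] -/
theorem exists_isMSWindow_of_crossing {c : ℝ} {τW : ℕ → ℝ} {W₀ : ℕ}
    (h₀ : 1 ≤ W₀) (hcross : c * τW W₀ ≤ W₀) : ∃ W, IsMSWindow c τW W ∧ W ≤ W₀ := by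
  classical
  have hex : ∃ W : ℕ, 1 ≤ W ∧ c * τW W ≤ W := ⟨W₀, h₀, hcross⟩
  refine ⟨Nat.find hex, ⟨(Nat.find_spec hex).1, (Nat.find_spec hex).2, ?_⟩, Nat.find_min' hex ⟨h₀, hcross⟩⟩
  intro W' hW'1 hW'lt
  have hmin := Nat.find_min hex hW'lt
  exact not_le.mp (fun h => hmin ⟨hW'1, h⟩)

/-- One more lag in the window adds `ρ (W+1)`. -/
theorem tauIntWindow_succ (ρ : ℕ → ℝ) (W : ℕ) :
    tauIntWindow ρ (W + 1) = tauIntWindow ρ W + ρ (W + 1) := by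
  simp only [tauIntWindow, Finset.sum_range_succ]
  ring

/-- For a non-negative autocorrelation function the windowed `τ̂_W` is monotone in the window. -/
theorem tauIntWindow_mono {ρ : ℕ → ℝ} (hρ : ∀ t, 0 ≤ ρ (t + 1)) : Monotone (tauIntWindow ρ) := by
  refine monotone_nat_of_le_succ fun W => ?_
  rw [tauIntWindow_succ]
  linarith [hρ W]

/-- At an MS window lying at or below a known crossing `W₀`, the reading is at most `W₀ / c`. -/
theorem tauIntWindow_le_of_isMSWindow_le {c : ℝ} (hc : 0 < c) {τW : ℕ → ℝ} {W W₀ : ℕ}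
    (hW : IsMSWindow c τW W) (hle : W ≤ W₀) : τW W ≤ W₀ / c := by
  have h1 : τW W ≤ W / c := tauIntWindow_le_div_of_isMSWindow hc hW
  have h2 : (W : ℝ) / c ≤ W₀ / c := div_le_div_of_nonneg_right (by exact_mod_cast hle) hc.le
  exact h1.trans h2

/-! ## The two-scale curve `ρ t = a r^t + b s^t`: closed forms -/

/-- The windowed sum splits into the two geometric windowed sums. -/
theorem tauIntWindow_mixture_split (a b r s : ℝ) (W : ℕ) :
    tauIntWindow (fun t => a * r ^ t + b * s ^ t) W
      = 1 / 2 + a * ∑ t ∈ Finset.range W, r ^ (t + 1) + b * ∑ t ∈ Finset.range W, s ^ (t + 1) := by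
  simp only [tauIntWindow, Finset.sum_add_distrib, Finset.mul_sum]
  ring

/-- Windowed geometric sum in `Finset` form: `Σ_{t<W} r^(t+1) = r (1 − r^W)/(1 − r)` for `r ≠ 1`. -/
theorem sum_range_pow_succ_eq {r : ℝ} (hr : r ≠ 1) (W : ℕ) :
    ∑ t ∈ Finset.range W, r ^ (t + 1) = r * (1 - r ^ W) / (1 - r) := by
  have h := tauIntWindow_geometric hr W
  simp only [tauIntWindow] at h
  linarith

/-- **Closed form** of the windowed two-scale sum (`r, s ≠ 1`):
`τ̂_W = ½ + a r(1 − r^W)/(1 − r) + b s(1 − s^W)/(1 − s)`. -/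
theorem tauIntWindow_mixture (a b : ℝ) {r s : ℝ} (hr : r ≠ 1) (hs : s ≠ 1) (W : ℕ) :
    tauIntWindow (fun t => a * r ^ t + b * s ^ t) W
      = 1 / 2 + a * (r * (1 - r ^ W) / (1 - r)) + b * (s * (1 - s ^ W) / (1 - s)) := by
  rw [tauIntWindow_mixture_split, sum_range_pow_succ_eq hr, sum_range_pow_succ_eq hs]

/-- **Truncation bias on the two-scale curve**: the window `W` misses exactly
`a r^(W+1)/(1 − r) + b s^(W+1)/(1 − s)` (`|r|, |s| < 1`). -/
theorem tauInt_sub_tauIntWindow_mixture (a b : ℝ) {r s : ℝ} (hr : |r| < 1) (hs : |s| < 1) (W : ℕ) :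
    tauInt (fun t => a * r ^ t + b * s ^ t) - tauIntWindow (fun t => a * r ^ t + b * s ^ t) W
      = a * (r ^ (W + 1) / (1 - r)) + b * (s ^ (W + 1) / (1 - s)) := by
  have hr1 : r ≠ 1 := ne_of_lt (abs_lt.mp hr).2
  have hs1 : s ≠ 1 := ne_of_lt (abs_lt.mp hs).2
  have h1 : (1 : ℝ) - r ≠ 0 := sub_ne_zero.mpr (Ne.symm hr1)
  have h2 : (1 : ℝ) - s ≠ 0 := sub_ne_zero.mpr (Ne.symm hs1)
  rw [tauInt_mixture a b hr hs, tauIntWindow_mixture a b hr1 hs1 W]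
  field_simp
  ring

/-! ## The trap: a slow component of amplitude below `1/c` cannot hold the window open -/

/-- The slow component contributes at most `b·W` to `τ̂_W` (each `s^(t+1) ≤ 1`), the fast one at most
its full sum `a r/(1 − r)`: an `s`-INDEPENDENT ceiling on the windowed two-scale sum. -/
theorem tauIntWindow_mixture_le {a b r s : ℝ} (ha : 0 ≤ a) (hb : 0 ≤ b) (hr0 : 0 < r) (hr1 : r < 1)
    (hs0 : 0 ≤ s) (hs1 : s ≤ 1) (W : ℕ) :
    tauIntWindow (fun t => a * r ^ t + b * s ^ t) W ≤ 1 / 2 + a * (r / (1 - r)) + b * W := by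
  rw [tauIntWindow_mixture_split]
  have hfast : ∑ t ∈ Finset.range W, r ^ (t + 1) ≤ r / (1 - r) := by
    have hlt := tauIntWindow_lt_tauInt_geometric hr0 hr1 W
    have habs : |r| < 1 := abs_lt.mpr ⟨by linarith, hr1⟩
    rw [tauInt_geometric habs] at hlt
    simp only [tauIntWindow] at hlt
    have h1 : (0 : ℝ) < 1 - r := by linarith
    have key : (1 + r) / (2 * (1 - r)) - 1 / 2 = r / (1 - r) := by
      field_simp
      ring
    linarith
  have hslow : ∑ t ∈ Finset.range W, s ^ (t + 1) ≤ W := by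
    have h : ∀ t ∈ Finset.range W, s ^ (t + 1) ≤ 1 := fun t _ => pow_le_one₀ hs0 hs1
    calc ∑ t ∈ Finset.range W, s ^ (t + 1) ≤ ∑ _t ∈ Finset.range W, (1 : ℝ) := Finset.sum_le_sum h
      _ = W := by simp
  have h1 := mul_le_mul_of_nonneg_left hfast ha
  have h2 := mul_le_mul_of_nonneg_left hslow hb
  linarith

/-- **The windowing trap.** If the slow amplitude is below `1/c` (`c·b < 1`), then every
`W₀ ≥ c(½ + a r/(1 − r))/(1 − c b)` is a Madras–Sokal crossing of the two-scale curve — for EVERY slow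
scale `s ∈ [0, 1]`.  [ours] -/
theorem ms_crossing_of_small_amplitude {a b r s c : ℝ} {W₀ : ℕ} (ha : 0 ≤ a) (hb : 0 ≤ b)
    (hr0 : 0 < r) (hr1 : r < 1) (hs0 : 0 ≤ s) (hs1 : s ≤ 1) (hc : 0 ≤ c) (hcb : c * b < 1)
    (hW₀ : c * (1 / 2 + a * (r / (1 - r))) / (1 - c * b) ≤ W₀) :
    c * tauIntWindow (fun t => a * r ^ t + b * s ^ t) W₀ ≤ W₀ := by
  have hden : 0 < 1 - c * b := by linarith
  have hW₀' : c * (1 / 2 + a * (r / (1 - r))) ≤ W₀ * (1 - c * b) := by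
    rwa [div_le_iff₀ hden] at hW₀
  have hle := mul_le_mul_of_nonneg_left (tauIntWindow_mixture_le ha hb hr0 hr1 hs0 hs1 W₀) hc
  have : c * (1 / 2 + a * (r / (1 - r)) + b * W₀) = c * (1 / 2 + a * (r / (1 - r))) + c * b * W₀ := by
    ring
  nlinarith

/-- **Bias at the MS window, two-scale curve.** If the MS window `W*` exists at `c` and `W₀ ≥ 1` is any
crossing, the window misses at least the full tail beyond `W₀`:
`τ_int − τ̂_{W*} ≥ a r^(W₀+1)/(1 − r) + b s^(W₀+1)/(1 − s)`. [ours] -/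
theorem bias_ge_of_isMSWindow_mixture {a b r s c : ℝ} {W W₀ : ℕ} (ha : 0 ≤ a) (hb : 0 ≤ b)
    (hr0 : 0 < r) (hr1 : r < 1) (hs0 : 0 < s) (hs1 : s < 1)
    (hW : IsMSWindow c (fun W => tauIntWindow (fun t => a * r ^ t + b * s ^ t) W) W)
    (h₀ : 1 ≤ W₀) (hcross : c * tauIntWindow (fun t => a * r ^ t + b * s ^ t) W₀ ≤ W₀) :
    a * (r ^ (W₀ + 1) / (1 - r)) + b * (s ^ (W₀ + 1) / (1 - s))
      ≤ tauInt (fun t => a * r ^ t + b * s ^ t) - tauIntWindow (fun t => a * r ^ t + b * s ^ t) W := by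
  have hle : W ≤ W₀ := isMSWindow_le_of_crossing hW h₀ hcross
  have hρ : ∀ t, 0 ≤ (fun t => a * r ^ t + b * s ^ t) (t + 1) := fun t => by
    show (0 : ℝ) ≤ a * r ^ (t + 1) + b * s ^ (t + 1)
    positivity
  have hmono := tauIntWindow_mono (ρ := fun t => a * r ^ t + b * s ^ t) hρ hle
  have habr : |r| < 1 := abs_lt.mpr ⟨by linarith, hr1⟩
  have habs : |s| < 1 := abs_lt.mpr ⟨by linarith, hs1⟩
  have heq := tauInt_sub_tauIntWindow_mixture a b habr habs W₀
  linarith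

/-- … in particular at least the slow tail `b s^(W₀+1)/(1 − s)`, which is unbounded as `s → 1` while
(previous lemma with `ms_crossing_of_small_amplitude`) `W₀` does not depend on `s`. -/
theorem slow_tail_le_bias_of_isMSWindow_mixture {a b r s c : ℝ} {W W₀ : ℕ} (ha : 0 ≤ a) (hb : 0 ≤ b)
    (hr0 : 0 < r) (hr1 : r < 1) (hs0 : 0 < s) (hs1 : s < 1)
    (hW : IsMSWindow c (fun W => tauIntWindow (fun t => a * r ^ t + b * s ^ t) W) W)
    (h₀ : 1 ≤ W₀) (hcross : c * tauIntWindow (fun t => a * r ^ t + b * s ^ t) W₀ ≤ W₀) :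
    b * (s ^ (W₀ + 1) / (1 - s))
      ≤ tauInt (fun t => a * r ^ t + b * s ^ t) - tauIntWindow (fun t => a * r ^ t + b * s ^ t) W := by
  have h := bias_ge_of_isMSWindow_mixture ha hb hr0 hr1 hs0 hs1 hW h₀ hcross
  have hfast : 0 ≤ a * (r ^ (W₀ + 1) / (1 - r)) := by
    have : 0 < 1 - r := by linarith
    positivity
  linarith

/-- **Relative form.** Under the same hypotheses (and `c > 0`) the relative truncation bias at the MS
window is at least `1 − (W₀/c)/τ_int`: with `W₀, c` fixed by the fast scale and the amplitudes alone,
it tends to `1` as the slow scale grows. [ours] -/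
theorem relBias_ge_of_isMSWindow_mixture {a b r s c : ℝ} {W W₀ : ℕ} (ha : 0 ≤ a) (hb : 0 ≤ b)
    (hr0 : 0 < r) (hr1 : r < 1) (hs0 : 0 < s) (hs1 : s < 1) (hc : 0 < c)
    (hW : IsMSWindow c (fun W => tauIntWindow (fun t => a * r ^ t + b * s ^ t) W) W)
    (h₀ : 1 ≤ W₀) (hcross : c * tauIntWindow (fun t => a * r ^ t + b * s ^ t) W₀ ≤ W₀) :
    1 - (W₀ / c) / tauInt (fun t => a * r ^ t + b * s ^ t)
      ≤ relBias (fun t => a * r ^ t + b * s ^ t) W := by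
  have habr : |r| < 1 := abs_lt.mpr ⟨by linarith, hr1⟩
  have habs : |s| < 1 := abs_lt.mpr ⟨by linarith, hs1⟩
  have hτpos : 0 < tauInt (fun t => a * r ^ t + b * s ^ t) := by
    rw [tauInt_mixture a b habr habs]
    have h1 : 0 < 1 - r := by linarith
    have h2 : 0 < 1 - s := by linarith
    positivity
  have hread : tauIntWindow (fun t => a * r ^ t + b * s ^ t) W ≤ W₀ / c :=
    tauIntWindow_le_of_isMSWindow_le hc hW (isMSWindow_le_of_crossing hW h₀ hcross)
  rw [relBias, sub_div, div_self hτpos.ne']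
  have := div_le_div_of_nonneg_right hread hτpos.le
  linarith

/-! ## C-1b of record (`a = 10/11, r = 1/2, b = 1/11, s = 999/1000`) at `c = 4` and `c = 6`

`c·b = 4/11` resp. `6/11 < 1`, so the trap applies; the thresholds `c(½ + a r/(1−r))/(1 − c b)` are
`62/7 = 8.86` and `93/5 = 18.6`, and the population MS windows are exactly the next integers. -/

/-- `1/2 ≠ 1` (the fast ratio of C-1b). -/
theorem C1b_r_ne_one : (1 / 2 : ℝ) ≠ 1 := by norm_num

/-- `999/1000 ≠ 1` (the slow ratio of C-1b). -/
theorem C1b_s_ne_one : (999 / 1000 : ℝ) ≠ 1 := by norm_num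

/-- Closed form of the windowed C-1b sum (an instance of `tauIntWindow_mixture`). -/
theorem tauIntWindow_C1b (W : ℕ) :
    tauIntWindow (fun t => (10 / 11 : ℝ) * (1 / 2 : ℝ) ^ t + (1 / 11 : ℝ) * (999 / 1000 : ℝ) ^ t) W
      = 1 / 2 + 10 / 11 * (1 / 2 * (1 - (1 / 2 : ℝ) ^ W) / (1 - 1 / 2))
        + 1 / 11 * (999 / 1000 * (1 - (999 / 1000 : ℝ) ^ W) / (1 - 999 / 1000)) :=
  tauIntWindow_mixture (10 / 11) (1 / 11) C1b_r_ne_one C1b_s_ne_one W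

/-- The population MS window of the C-1b curve at `c = 4` is `W* = 9` (scorer A's scan of record on a
C-1b sample: `W = 9`). -/
theorem isMSWindow_C1b_c4 :
    IsMSWindow 4 (fun W => tauIntWindow
      (fun t => (10 / 11 : ℝ) * (1 / 2 : ℝ) ^ t + (1 / 11 : ℝ) * (999 / 1000 : ℝ) ^ t) W) 9 := by
  refine ⟨by norm_num, ?_, ?_⟩
  · simp only [tauIntWindow_C1b]
    norm_num
  · intro W' h1 h2
    interval_cases W' <;>
      · simp only [tauIntWindow_C1b]
        norm_num

/-- The population MS window of the C-1b curve at `c = 6` (scorer B's window of record) is `W* = 19`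
(scorer A's scan of record on a C-1b sample: `W = 19`). -/
theorem isMSWindow_C1b_c6 :
    IsMSWindow 6 (fun W => tauIntWindow
      (fun t => (10 / 11 : ℝ) * (1 / 2 : ℝ) ^ t + (1 / 11 : ℝ) * (999 / 1000 : ℝ) ^ t) W) 19 := by
  refine ⟨by norm_num, ?_, ?_⟩
  · simp only [tauIntWindow_C1b]
    norm_num
  · intro W' h1 h2
    interval_cases W' <;>
      · simp only [tauIntWindow_C1b]
        norm_num

/-- The reading at `c = 4`: `2.221 < τ̂_9 < 2.222` (sample of record: 2.2147; `τ_int = 92.23`). -/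
theorem tauIntWindow_C1b_9_bounds :
    2221 / 1000 < tauIntWindow
        (fun t => (10 / 11 : ℝ) * (1 / 2 : ℝ) ^ t + (1 / 11 : ℝ) * (999 / 1000 : ℝ) ^ t) 9 ∧
      tauIntWindow
        (fun t => (10 / 11 : ℝ) * (1 / 2 : ℝ) ^ t + (1 / 11 : ℝ) * (999 / 1000 : ℝ) ^ t) 9
          < 2222 / 1000 := by
  rw [tauIntWindow_C1b]
  constructor <;> norm_num

/-- The reading at `c = 6`: `3.119 < τ̂_19 < 3.120` (sample of record: 3.0986; `τ_int = 92.23`). -/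
theorem tauIntWindow_C1b_19_bounds :
    3119 / 1000 < tauIntWindow
        (fun t => (10 / 11 : ℝ) * (1 / 2 : ℝ) ^ t + (1 / 11 : ℝ) * (999 / 1000 : ℝ) ^ t) 19 ∧
      tauIntWindow
        (fun t => (10 / 11 : ℝ) * (1 / 2 : ℝ) ^ t + (1 / 11 : ℝ) * (999 / 1000 : ℝ) ^ t) 19
          < 3120 / 1000 := by
  rw [tauIntWindow_C1b]
  constructor <;> norm_num

/-- **C-1b, `c = 4`: the MS window under-reads `τ_int` by more than 97.5 %.** -/
theorem relBias_C1b_c4_gt :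
    975 / 1000 < relBias
      (fun t => (10 / 11 : ℝ) * (1 / 2 : ℝ) ^ t + (1 / 11 : ℝ) * (999 / 1000 : ℝ) ^ t) 9 := by
  rw [relBias, tauInt_C1b, tauIntWindow_C1b]
  norm_num

/-- **C-1b, `c = 6`: the MS window of record under-reads `τ_int` by more than 96.6 %.** -/
theorem relBias_C1b_c6_gt :
    966 / 1000 < relBias
      (fun t => (10 / 11 : ℝ) * (1 / 2 : ℝ) ^ t + (1 / 11 : ℝ) * (999 / 1000 : ℝ) ^ t) 19 := by
  rw [relBias, tauInt_C1b, tauIntWindow_C1b]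
  norm_num

end Summit.Ventures.LatticeQCDFlow.Scoring
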